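import Mathlib.Algebra.Lie.OfAssociative
import Literature.AlgebraicGeometry.Motives.AtypicalHodgeLocus
import Literature.AlgebraicGeometry.Motives.FamiliesVHSGaussManin
import Literature.AlgebraicGeometry.Motives.PeriodRealizationClassical
import Literature.AlgebraicGeometry.HodgeTheory.GlobalInvariantCycles
import HarnessLib

/-!
# In level at least three the Hodge locus of positive period dimension is algebraic
# (Baldi–Klingler–Ullmo 2024, Thm. 2.6; the level of a variation, Def. 3.12–3.13)

Family `hodge`, layer `Literature/AlgebraicGeometry/Motives`, next to `AtypicalHodgeLocus` (the
vocabulary of G. Baldi, B. Klingler, E. Ullmo, *On the distribution of the Hodge locus*, Invent.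
Math. 235 (2024) 441–487 = arXiv:2107.08838 [BaldiKlinglerUllmo2024, "BKU"]; held text
`paper:arxiv-2107.08838`, numbering of the version of record), whose module docstring lists as
"Not here": "The LEVEL of `𝕍` (BKU Def. 3.12–3.13 …) … the BKU theorems themselves (to be vendored
as named facts over this vocabulary)". Written by the cross-ladder literature-typing seat
`littype-FH1-2` (cell `hodge-nonav`) for the rung R-W7″ of `HodgeConjecture` (planner memo
ROUTE-P3v17-g24-ADD1/ADD4: the antecedent "BKU 2.6" of the quartic cone-family statement, applied
to a sub-`ℤ`VHS `T^⊥ ⊂ R^{2k} f_* ℤ` of geometric origin whose generic adjoint Mumford–Tate group is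
the simple group `PSO`), which is why the fact is stated for SUB-VHS data of Gauss–Manin data and in
the simple-adjoint form. TWO named facts: `bku2024_hodgeLocusPos_finite_of_levelAtLeastThree` (Thm. 2.6) and,
appended, its companion `cdk1995_hodgeLocus_subVHS_countable_strictSpecial` (Thm. 1.1 = Cattani–Deligne–Kaplan,
for the same sub-VHS data; last section); the rest are definitions with bodies and proved lemmas.

## Source, verbatim (held text `paper:arxiv-2107.08838`)

* p. 3, **Def. 1.2**: "A subvariety `Z` of `S` is said of positive period dimension for `𝕍` if
  `Φ(Z^an)` has positive dimension. If moreover the projection of `Φ(Z^an)` on each factor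
  `Γᵢ \ Dᵢ` … has positive dimension, then `Z` is said to be factorwise of positive period
  dimension. The Hodge locus of positive period dimension (resp. factorwise of positive period
  dimension) `HL(S, 𝕍^⊗)_pos` (resp. `HL(S, 𝕍^⊗)_fpos`) is the union of the special subvarieties
  of `S` for `𝕍` of positive period dimension (resp. factorwise …). Thus
  `HL(S, 𝕍^⊗)_fpos ⊂ HL(S, 𝕍^⊗)_pos ⊂ HL(S, 𝕍^⊗)` and the first inclusion is an equality if `G^ad`
  is simple." **Rmk. 1.4**: "Saying that `HL(S, 𝕍^⊗)_fpos` is algebraic is equivalent to saying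
  that the set of strict special subvarieties of `S` for `𝕍` factorwise of positive period
  dimension has only finitely many maximal elements for the inclusion."
* p. 5, **Thm. 2.6**: "Let `𝕍` be a polarizable `ℤ`VHS on a smooth connected complex
  quasi-projective variety `S`. If `𝕍` is of level at least `3` then `HL(S, 𝕍^⊗)_fpos` is a finite
  union of maximal atypical special subvarieties (hence is algebraic). In particular, if moreover
  `G^ad` is simple, then `HL(S, 𝕍^⊗)_pos` is algebraic in `S`." Proof, §7.1 (p. 21): "The
  combination of the two gives that `HL(S, 𝕍^⊗)_fpos` is algebraic, and in fact a finite union of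
  maximal atypical subvarieties. From this, we also have that, if `G^ad` is simple, then
  `HL(S, 𝕍^⊗)_fpos = HL(S, 𝕍^⊗)_pos` is algebraic in `S`."
* p. 9, §3.1: "`𝔤^der = [𝔤, 𝔤]` its derived Lie algebra. When … `𝔤` is reductive the natural
  morphism `𝔤^der → 𝔤^ad` is an isomorphism"; "the Mumford–Tate group … is also the fixator in
  `GL(V)` of the Hodge tensors … As `H` is polarised, this is a reductive group." §3.2: "A point `s`
  of `Y^an` is said to be Hodge-generic in `Y` for `𝕍` if `MT(𝕍_{s,ℚ})` has maximal dimension …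
  called the generic Mumford–Tate group `G_Y`". p. 10–11, **Rmk. 3.10**: "If `𝔤` is a
  `K`-Hodge–Lie algebra then any factor of the Lie algebra `𝔤` is a `K`-Hodge–Lie subalgebra of
  `𝔤`. In particular the derived Lie algebra `𝔤^der` … is equal to the adjoint `K`-Hodge–Lie
  algebra `𝔤^ad` quotient of `𝔤` by its center; and being simple as a `K`-Hodge–Lie algebra is
  equivalent to being simple as a `K`-Lie algebra." **Def. 3.12**: "Given an irreducible
  polarizable `ℝ`-Hodge structure `V_ℝ` of weight zero (thus `V_ℂ = ⊕_k V^{k,-k}`) its level is the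
  largest integer `k` such that `V^{k,-k} ≠ 0`. We define the level of an irreducible polarizable
  `ℚ`-Hodge structure `V` as the maximum of the levels of the irreducible factors of `V_ℝ`, and the
  level of a polarizable `ℚ`-Hodge structure as the minimum of the levels of its `ℚ`-factors."
  **Def. 3.13**: "The level of `𝕍` is the level of the `ℚ`-Hodge–Lie algebra `𝔤^ad_x` for `x` any
  Hodge generic point of `D`" (`(G, D)` the generic Hodge datum; "One immediately checks that the
  levels … are independent of the choice of the Hodge generic point").

## Rendering

* **Lie ideals on submodules of `End V`.** The tree's Mumford–Tate Lie algebra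
  `HodgeStructure.mumfordTateLieAlgebra H ⊆ End V` (`AtypicalHodgeLocus`) is a `ℚ`-submodule; with
  the commutator bracket of Mathlib's `LieRing.ofAssociativeRing` on `Module.End ℚ V` we set
  `lieDerivedSubmodule 𝔤 = ⟨[X, Y] | X, Y ∈ 𝔤⟩` (`𝔤^der`), `IsLieIdealIn 𝔤 𝔞` and
  `IsSimpleLieFactor 𝔤 𝔞`: `𝔞` is a minimal non-zero ideal of `𝔤` contained in `𝔤^der` — for
  reductive `𝔤 = 𝔷 ⊕ 𝔤^der` these are exactly the `ℚ`-simple factors of `𝔤^der ≅ 𝔤^ad` (an ideal of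
  `𝔤` inside `𝔤^der` is an ideal of `𝔤^der` and conversely, `[𝔷, ·] = 0`).
* **Level** (Def. 3.12–3.13). For a `ℚ`-sub-Hodge structure `𝔞 ⊆ End V = Hom(H, H)` (weight `0`,
  tree `HodgeStructure.hom H H`) the `(k,-k)`-component of `𝔞_ℂ` is `𝔞_ℂ ∩ End(V)^{k,-k}`, and for
  an IRREDUCIBLE `ℚ`-Hodge structure Def. 3.12's "maximum over the irreducible factors of `𝔞_ℝ` of
  the largest `k` with `𝔞ᵢ^{k,-k} ≠ 0`" is the largest `k` with `𝔞^{k,-k} ≠ 0` (the `𝔞ᵢ^{k,-k}`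
  sum to `𝔞^{k,-k}`). Hence `HodgeStructure.HasHodgeLevelAtLeast H 𝔞 ℓ :↔ ∃ k ≥ ℓ, 𝔞_ℂ ∩
  End(V)^{k,-k} ≠ 0` is "level of `𝔞` ≥ `ℓ`", and `VHSData.LevelAtLeast D ℓ` — at every
  Hodge-generic point `s` of `S` (`IsHodgeGenericIn Set.univ`, BKU §3.2 verbatim; there the
  Mumford–Tate Lie algebra is the generic one `𝔤 = Lie G_S` with the Hodge–Lie structure of `h_s`),
  every `ℚ`-simple factor of `𝔤^ad ≅ 𝔤^der` (Rmk. 3.10: factors are Hodge–Lie subalgebras, i.e.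
  sub-Hodge structures) has level `≥ ℓ` — is "the level of `𝕍` is at least `ℓ`" (minimum over the
  `ℚ`-factors `≥ ℓ`; vacuous when `𝔤^der = 0`, where the period domain is a point and the theorems
  below are empty). `VHSData.HasSimpleAdjointGroup D`: `𝔤^der` itself is a minimal non-zero ideal
  ("`G^ad` is simple", a `ℚ`-simple group, as in BKU §3.3's decomposition `G^ad = G₁ × ⋯ × G_r` and
  §7.2 "`G_{n,d}` … is a simple `ℚ`-algebraic group").
* **Honesty.** `VHSData` / `GeometricVHSData` are hypothesis structures (holomorphy and Griffiths
  transversality are not recorded; `Motives/FamiliesVHS`). As in the sibling facts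
  (`SpecialSubvarietiesCountable`, `HodgeTheory.bku_finite_monodromyOrbit_of_isHodgeGenericIn`) the
  theorem is therefore stated for data pinned to geometry: a CLASSICAL Betti–Hodge datum `B`
  (`BettiHodgeData.IsClassical`: the fibrewise Hodge structures are THE Hodge structures of the
  fibres) and a geometric VHS datum `D` of `Rⁱ f_* ℚ` which `IsGaussManin` (`FamiliesVHSGaussManin`:
  `(D.V, fiberIso)` is the Gauss–Manin local system, transport = honest parallel transport). The
  notions entering the statement — `mtRankAt` (hence Hodge-genericity, special subvarieties, the
  Mumford–Tate Lie algebra), `PeriodEquiv`/`HasPositivePeriodDimension` (transport of the Hodge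
  filtration) — read only these pinned fields. To serve variations that are not a full `Rⁱ f_* ℚ`
  (the consumer's `T^⊥`), the fact quantifies over every `D' : VHSData` EMBEDDED in such a `D`
  (`VHSData.IsSubVHSDatumOf D' D`: fibrewise injections `ι_s : V'_s ↪ V_s` commuting with transport,
  with `F'^p = ι_s,ℂ⁻¹ F^p`). Such a `D'` underlies an honest polarizable `ℤ`VHS: `V' ⊗ 𝒪` is a flat
  holomorphic subbundle; since each `D'.hodge s` is a Hodge structure with the induced filtration,
  `V'_s ⊆ V_s` is a sub-Hodge structure, so the ranks of `F^p ∩ V'` are constant (opposedness: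
  `dim(F^p ∩ V'_s) + dim(F^{n+1-p} ∩ V'_s) = dim V'`, both terms upper semicontinuous) and the
  `F'^p` are holomorphic subbundles, Griffiths-transversal inside `V'`; `D'.form` is a flat
  polarization and `D'.VZ` a flat lattice by the `VHSData` fields. `D` itself is the case `ι = id`
  (`IsSubVHSDatumOf.refl`).
  -- TODO(general form): BKU Thm. 2.6 holds for every polarizable `ℤ`VHS on a smooth connected
  -- quasi-projective `S` and concludes on `HL(S, 𝕍^⊗)_fpos` without "`G^ad` simple"; only sub-VHS
  -- of geometric variations `Rⁱ f_* ℚ` and the simple-adjoint case (`fpos = pos`, printed) are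
  -- rendered — "factorwise" period dimension needs the factor decomposition of the period domain.
* **Conclusion.** The tree's `IsMaximalAtypicalSpecialSubvariety D Ssing` takes BKU's singular
  locus `S^sing_𝕍 = Φ⁻¹((Φ(S^an))^sing)` (Def. 1.6) as a PARAMETER `Ssing` not constructible from `D`
  (no period map in the tree), and a named fact cannot quantify over it. The fact therefore records
  Thm. 2.6 (simple-adjoint case) in the printed equivalent form of Rmk. 1.4 / "hence is algebraic":
  `HL(S, 𝕍^⊗)_pos` (`VHSData.hodgeLocusPos`: the union of the strict special subvarieties of positive
  period dimension) is the union of a FINITE set of strict special subvarieties of positive period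
  dimension; that it is then Zariski-closed in `S(ℂ)` is PROVED (`hodgeLocusPos_isZariskiClosed_of`).
  What is not rendered: that the finitely many maximal ones are ATYPICAL (Def. 1.8/4.2).
* Not typed here: Thm. 2.3 (level `≥ 3` ⟹ `HL(S, 𝕍^⊗)_typ = ∅`) — it is a statement about
  `S^sing_𝕍` and the Hodge codimension; an `∃ Ssing`-rendering would be emptied by BKU's own
  Conj. 2.5 (`HL` algebraic in level `≥ 3`). Thm. 2.1 (geometric Zilber–Pink) likewise. Cor. 2.7
  (hypersurfaces, `n ≥ 3`, `d > 5`) needs the primitive sub-datum of the universal family.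

## References
* [BaldiKlinglerUllmo2024] G. Baldi, B. Klingler, E. Ullmo, On the distribution of the Hodge locus,
  Invent. Math. 235 (2024) 441–487, arXiv:2107.08838: Def. 1.2, Rmk. 1.4, Thm. 2.6, §3.1–3.3,
  Rmk. 3.10, Def. 3.12, Def. 3.13, §7.1.
* [KlinglerOtwinowskaUrbanik2023] B. Klingler, A. Otwinowska, D. Urbanik, Ann. Sci. ÉNS 56 (2023),
  Prop. 2.1 (= BKU Lemma 3.6, the tree's `IsSpecialSubvariety`).
* [Deligne1982HodgeCycles] P. Deligne, Hodge cycles on abelian varieties, LNM 900, I §3 (Mumford–Tate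
  group and its Lie algebra).
-/

noncomputable section

open CategoryTheory AlgebraicGeometry
open scoped TensorProduct

namespace Literature.AlgebraicGeometry.Motives

universe u

/-! ### Lie ideals of a Lie algebra given as a submodule of `End V` -/

section LieIdeals

variable {V : Type u} [AddCommGroup V] [Module ℚ V]

/-- The **derived Lie algebra** `𝔤^der = [𝔤, 𝔤]` of a `ℚ`-submodule `𝔤 ⊆ End V` (closed under the
commutator bracket `[X, Y] = XY - YX` in the applications): the `ℚ`-span of the brackets of
elements of `𝔤` (BKU §3.1: "`𝔤^der = [𝔤, 𝔤]` its derived Lie algebra"; for reductive `𝔤`,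
`𝔤^der ≅ 𝔤^ad`). [cite: BaldiKlinglerUllmo2024, §3.1] -/
def lieDerivedSubmodule (𝔤 : Submodule ℚ (Module.End ℚ V)) : Submodule ℚ (Module.End ℚ V) :=
  Submodule.span ℚ {Z | ∃ X ∈ 𝔤, ∃ Y ∈ 𝔤, Z = ⁅X, Y⁆}

/-- Brackets of elements of `𝔤` lie in `𝔤^der = [𝔤, 𝔤]`. [cite: BaldiKlinglerUllmo2024, §3.1] -/
theorem lie_mem_lieDerivedSubmodule {𝔤 : Submodule ℚ (Module.End ℚ V)} {X Y : Module.End ℚ V}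
    (hX : X ∈ 𝔤) (hY : Y ∈ 𝔤) : ⁅X, Y⁆ ∈ lieDerivedSubmodule 𝔤 :=
  Submodule.subset_span ⟨X, hX, Y, hY, rfl⟩

/-- `𝔞` **is a Lie ideal of** `𝔤` (both `ℚ`-submodules of `End V` with the commutator bracket):
`𝔞 ⊆ 𝔤` and `[𝔤, 𝔞] ⊆ 𝔞` (the "factors" of BKU §3.1/§3.3 are ideals of `𝔤`).
[cite: BaldiKlinglerUllmo2024, §3.1] -/
def IsLieIdealIn (𝔤 𝔞 : Submodule ℚ (Module.End ℚ V)) : Prop :=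
  𝔞 ≤ 𝔤 ∧ ∀ X ∈ 𝔤, ∀ Y ∈ 𝔞, ⁅X, Y⁆ ∈ 𝔞

/-- The zero submodule is a Lie ideal. [cite: BaldiKlinglerUllmo2024, §3.1] -/
theorem isLieIdealIn_bot (𝔤 : Submodule ℚ (Module.End ℚ V)) : IsLieIdealIn 𝔤 ⊥ :=
  ⟨bot_le, fun X _ Y hY => by
    rw [Submodule.mem_bot] at hY ⊢
    rw [hY, Ring.lie_def, mul_zero, zero_mul, sub_zero]⟩

/-- A submodule closed under the bracket is a Lie ideal of itself. [cite: BaldiKlinglerUllmo2024, §3.1] -/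
theorem isLieIdealIn_self {𝔤 : Submodule ℚ (Module.End ℚ V)}
    (h : ∀ X ∈ 𝔤, ∀ Y ∈ 𝔤, ⁅X, Y⁆ ∈ 𝔤) : IsLieIdealIn 𝔤 𝔤 :=
  ⟨le_rfl, h⟩

/-- `𝔞` **is a `ℚ`-simple factor of `𝔤^ad`**, rendered inside `𝔤 ⊆ End V`: a minimal non-zero Lie
ideal of `𝔤` contained in the derived algebra `𝔤^der = [𝔤, 𝔤]`. For reductive `𝔤 = 𝔷 ⊕ 𝔤^der`
(e.g. a Mumford–Tate Lie algebra, BKU §3.1) the ideals of `𝔤` inside `𝔤^der` are the ideals of the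
semisimple `𝔤^der ≅ 𝔤^ad`, whose minimal non-zero ideals are its simple factors (BKU §3.3:
"the decomposition of the adjoint group `G^ad` into a product `G₁ × ⋯ × G_r` of simple factors";
Rmk. 3.10: for a Hodge–Lie algebra every factor is a Hodge–Lie subalgebra).
[cite: BaldiKlinglerUllmo2024, §3.1, §3.3 and Rmk. 3.10] -/
def IsSimpleLieFactor (𝔤 𝔞 : Submodule ℚ (Module.End ℚ V)) : Prop :=
  IsLieIdealIn 𝔤 𝔞 ∧ 𝔞 ≤ lieDerivedSubmodule 𝔤 ∧ 𝔞 ≠ ⊥ ∧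
    ∀ 𝔟 : Submodule ℚ (Module.End ℚ V), IsLieIdealIn 𝔤 𝔟 → 𝔟 ≤ 𝔞 → 𝔟 = ⊥ ∨ 𝔟 = 𝔞

/-- A simple factor is non-zero. [cite: BaldiKlinglerUllmo2024, §3.3] -/
theorem IsSimpleLieFactor.ne_bot {𝔤 𝔞 : Submodule ℚ (Module.End ℚ V)} (h : IsSimpleLieFactor 𝔤 𝔞) :
    𝔞 ≠ ⊥ := h.2.2.1

/-- A simple factor lies in the derived algebra `𝔤^der ≅ 𝔤^ad`. [cite: BaldiKlinglerUllmo2024, §3.1 and §3.3] -/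
theorem IsSimpleLieFactor.le_lieDerivedSubmodule {𝔤 𝔞 : Submodule ℚ (Module.End ℚ V)}
    (h : IsSimpleLieFactor 𝔤 𝔞) : 𝔞 ≤ lieDerivedSubmodule 𝔤 := h.2.1

/-- The zero submodule is not a simple factor (so "all simple factors have level `≥ ℓ`" is vacuous
exactly when `𝔤` has no minimal non-zero ideal inside `𝔤^der`, e.g. when `𝔤^der = 0`).
[cite: BaldiKlinglerUllmo2024, §3.3] -/
theorem not_isSimpleLieFactor_bot (𝔤 : Submodule ℚ (Module.End ℚ V)) : ¬ IsSimpleLieFactor 𝔤 ⊥ :=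
  fun h => h.ne_bot rfl

end LieIdeals

/-! ### The level of a sub-Hodge structure of `End V` and of a variation (BKU Def. 3.12–3.13) -/

namespace HodgeStructure

variable {V : Type u} [AddCommGroup V] [Module ℚ V] [HodgeTensorFacts.{u, u}] [Module.Finite ℚ V]
  {n : ℤ}

/-- **The Hodge level of `𝔞 ⊆ End V` is at least `ℓ`** (BKU Def. 3.12 for the weight-`0` Hodge
structure `End V = Hom(H, H)`, tree `HodgeStructure.hom H H`, restricted to a `ℚ`-sub-Hodge structure
`𝔞`, whose `(k,-k)`-component is `𝔞_ℂ ∩ End(V)^{k,-k}`): some component `𝔞^{k,-k}` with `k ≥ ℓ` is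
non-zero. For an irreducible `ℚ`-Hodge structure `𝔞`, Def. 3.12's level — "the maximum of the levels
of the irreducible factors of `𝔞_ℝ`", each being "the largest integer `k` such that `V^{k,-k} ≠ 0`"
— is the largest `k` with `𝔞^{k,-k} ≠ 0`, so this is "level(`𝔞`) `≥ ℓ`". [cite: BaldiKlinglerUllmo2024, Def. 3.12] -/
def HasHodgeLevelAtLeast (H : HodgeStructure V n) (𝔞 : Submodule ℚ (Module.End ℚ V)) (ℓ : ℕ) :
    Prop :=
  ∃ k : ℤ, (ℓ : ℤ) ≤ k ∧ 𝔞.baseChange ℂ ⊓ (H.hom H).piece k (-k) ≠ ⊥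

/-- Level `≥ ℓ` implies level `≥ ℓ'` for `ℓ' ≤ ℓ` (Def. 3.12's level is a maximum).
[cite: BaldiKlinglerUllmo2024, Def. 3.12] -/
theorem HasHodgeLevelAtLeast.mono {H : HodgeStructure V n} {𝔞 : Submodule ℚ (Module.End ℚ V)}
    {ℓ ℓ' : ℕ} (hℓ : ℓ' ≤ ℓ) (h : H.HasHodgeLevelAtLeast 𝔞 ℓ) : H.HasHodgeLevelAtLeast 𝔞 ℓ' := by
  obtain ⟨k, hk, hne⟩ := h
  exact ⟨k, le_trans (by exact_mod_cast hℓ) hk, hne⟩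

/-- A sub-Hodge structure of level `≥ ℓ` is non-zero. [cite: BaldiKlinglerUllmo2024, Def. 3.12] -/
theorem HasHodgeLevelAtLeast.ne_bot {H : HodgeStructure V n} {𝔞 : Submodule ℚ (Module.End ℚ V)}
    {ℓ : ℕ} (h : H.HasHodgeLevelAtLeast 𝔞 ℓ) : 𝔞 ≠ ⊥ := by
  rintro rfl
  obtain ⟨k, -, hne⟩ := h
  exact hne (by simp [Submodule.baseChange_bot])

end HodgeStructure

namespace VHSData

section Level

variable {S : Type} [TopologicalSpace S] {n : ℤ} [HodgeTensorFacts.{0, 0}]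

/-- **The level of the variation is at least `ℓ`** (BKU Def. 3.13: "The level of `𝕍` is the level
of the `ℚ`-Hodge–Lie algebra `𝔤^ad_x` for `x` any Hodge generic point", with Def. 3.12: "the level
of a polarizable `ℚ`-Hodge structure [is] the minimum of the levels of its `ℚ`-factors"): at every
point `s` Hodge-generic in `S` (`IsHodgeGenericIn Set.univ s`, BKU §3.2; there `𝔪𝔱(V_s)` is the
generic Mumford–Tate Lie algebra `𝔤 = Lie G_S` with the Hodge–Lie structure defined by `h_s`, and
BKU note the level does not depend on the generic point), every `ℚ`-simple factor `𝔞` of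
`𝔤^ad ≅ 𝔤^der` (`IsSimpleLieFactor`; a sub-Hodge structure by Rmk. 3.10) has Hodge level `≥ ℓ`
(`HodgeStructure.HasHodgeLevelAtLeast`). Vacuous if `𝔤^der = 0` (constant period map) or if `S` has
no Hodge-generic point (e.g. `S = ∅`). Meaningful for `D` underlying an honest polarizable
`ℤ`VHS. [cite: BaldiKlinglerUllmo2024, Def. 3.13 and Def. 3.12] -/
def LevelAtLeast (D : VHSData S n) [∀ s : S, Module.Finite ℚ (D.V.fiber s)] (ℓ : ℕ) : Prop :=
  ∀ s : S, D.IsHodgeGenericIn Set.univ s →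
    ∀ 𝔞 : Submodule ℚ (Module.End ℚ (D.V.fiber s)),
      IsSimpleLieFactor (D.hodge s).mumfordTateLieAlgebra 𝔞 → (D.hodge s).HasHodgeLevelAtLeast 𝔞 ℓ

/-- Level `≥ ℓ` implies level `≥ ℓ'` for `ℓ' ≤ ℓ`. [cite: BaldiKlinglerUllmo2024, Def. 3.13] -/
theorem LevelAtLeast.mono {D : VHSData S n} [∀ s : S, Module.Finite ℚ (D.V.fiber s)] {ℓ ℓ' : ℕ}
    (hℓ : ℓ' ≤ ℓ) (h : D.LevelAtLeast ℓ) : D.LevelAtLeast ℓ' :=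
  fun s hs 𝔞 h𝔞 => (h s hs 𝔞 h𝔞).mono hℓ

/-- **The adjoint generic Mumford–Tate group `G^ad` is (`ℚ`-)simple** (the hypothesis "if moreover
`G^ad` is simple" of BKU Thm. 2.6, after which `HL(S, 𝕍^⊗)_fpos = HL(S, 𝕍^⊗)_pos`, Def. 1.2): at
every Hodge-generic point `s` of `S` the derived algebra `𝔤^der = [𝔤, 𝔤]` of the (generic)
Mumford–Tate Lie algebra `𝔤 = 𝔪𝔱(V_s)` is itself a minimal non-zero Lie ideal of `𝔤`, i.e.
`𝔤^ad ≅ 𝔤^der` is simple (and non-zero). Meaningful for `D` underlying an honest polarizable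
`ℤ`VHS. [cite: BaldiKlinglerUllmo2024, Def. 1.2 and Thm. 2.6] -/
def HasSimpleAdjointGroup (D : VHSData S n) [∀ s : S, Module.Finite ℚ (D.V.fiber s)] : Prop :=
  ∀ s : S, D.IsHodgeGenericIn Set.univ s →
    IsSimpleLieFactor (D.hodge s).mumfordTateLieAlgebra
      (lieDerivedSubmodule (D.hodge s).mumfordTateLieAlgebra)

end Level

/-! ### Sub-VHS data -/

section Sub

variable {S : Type} [TopologicalSpace S] {n : ℤ}

/-- `D'` **is a sub-VHS datum of `D`** (same base, same weight): there are fibrewise injective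
`ℚ`-linear maps `ι_s : V'_s ↪ V_s` commuting with parallel transport (`V'` is a sub-local system of
`V`) under which the Hodge filtration of `V'_s` is induced from that of `V_s`, `F'^p = ι_{s,ℂ}⁻¹(F^p)`
(so `V'_s ⊆ V_s` is a sub-Hodge structure, `D'.hodge s` being a Hodge structure). The integral
structure `D'.VZ` and the flat polarization `D'.form` of `D'` are those of the `VHSData` fields (any
flat lattice, any flat polarization of the sub-structures). For `D` underlying an honest polarized
VHS `𝕍` (e.g. a Gauss–Manin `GeometricVHSData`, `D.IsGaussManin`, relative to a classical
Betti–Hodge datum), such a `D'` underlies an honest polarizable sub-`ℤ`VHS `𝕍' ⊆ 𝕍` (BKU §1.1: a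
`ℤ`VHS is a local system with a filtered regular flat connection whose fibres are Hodge structures;
a flat subbundle with sub-Hodge-structure fibres inherits holomorphic Hodge subbundles of constant
rank and Griffiths transversality) — the form in which the BKU theorems are consumed for
`T^⊥ ⊂ R^{2k} f_* ℤ`. [cite: BaldiKlinglerUllmo2024, §1.1] -/
def IsSubVHSDatumOf (D' D : VHSData S n) : Prop :=
  ∃ ι : ∀ s : S, D'.V.fiber s →ₗ[ℚ] D.V.fiber s,
    (∀ s, Function.Injective (ι s)) ∧
    (∀ (s t : S) (γ : Path.Homotopic.Quotient s t),
      ι t ∘ₗ D'.V.transport γ = D.V.transport γ ∘ₗ ι s) ∧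
    ∀ (s : S) (p : ℤ), (D'.hodge s).F p = ((D.hodge s).F p).comap ((ι s).baseChange ℂ)

/-- Every VHS datum is a sub-VHS datum of itself (`ι = id`; `𝕍 ⊆ 𝕍`). [cite: BaldiKlinglerUllmo2024, §1.1] -/
theorem IsSubVHSDatumOf.refl (D : VHSData S n) : D.IsSubVHSDatumOf D := by
  refine ⟨fun s => LinearMap.id, fun s => Function.injective_id, fun s t γ => ?_, fun s p => ?_⟩
  · rw [LinearMap.id_comp, LinearMap.comp_id]
  · rw [LinearMap.baseChange_id, Submodule.comap_id]

/-- The embedding of a sub-VHS datum intertwines the transports, pointwise (a sub-local system).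
[cite: BaldiKlinglerUllmo2024, §1.1] -/
theorem IsSubVHSDatumOf.exists_transport_comm {D' D : VHSData S n} (h : D'.IsSubVHSDatumOf D) :
    ∃ ι : ∀ s : S, D'.V.fiber s →ₗ[ℚ] D.V.fiber s, (∀ s, Function.Injective (ι s)) ∧
      ∀ (s t : S) (γ : Path.Homotopic.Quotient s t) (x : D'.V.fiber s),
        ι t (D'.V.transport γ x) = D.V.transport γ (ι s x) := by
  obtain ⟨ι, hinj, hcomm, -⟩ := h
  exact ⟨ι, hinj, fun s t γ x => LinearMap.congr_fun (hcomm s t γ) x⟩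

end Sub

end VHSData

/-! ### The named fact: BKU Thm. 2.6 (simple-adjoint case) -/

open Literature.AlgebraicGeometry.HodgeTheory (IsQuasiProjectiveOver)

/-- **In level at least three the Hodge locus of positive period dimension is a finite union of
strict special subvarieties, hence algebraic** (Baldi–Klingler–Ullmo 2024, Thm. 2.6: "Let `𝕍` be a
polarizable `ℤ`VHS on a smooth connected complex quasi-projective variety `S`. If `𝕍` is of level at
least `3` then `HL(S, 𝕍^⊗)_fpos` is a finite union of maximal atypical special subvarieties (hence is
algebraic). In particular, if moreover `G^ad` is simple, then `HL(S, 𝕍^⊗)_pos` is algebraic in `S`",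
with Def. 1.2 ("`HL(S, 𝕍^⊗)_fpos ⊂ HL(S, 𝕍^⊗)_pos` … is an equality if `G^ad` is simple"), the proof
§7.1 ("if `G^ad` is simple, then `HL(S, 𝕍^⊗)_fpos = HL(S, 𝕍^⊗)_pos` is algebraic") and Rmk. 1.4
(algebraic ⟺ "the set of strict special subvarieties of `S` for `𝕍` [factorwise] of positive period
dimension has only finitely many maximal elements for the inclusion")). On the tree's carriers
(module docstring, *Honesty*): for a classical Betti–Hodge datum `B`, a smooth projective family
`f : 𝒳 ⟶ S` over a smooth irreducible quasi-projective `ℂ`-scheme `S`, a Gauss–Manin geometric VHS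
datum `D` of `Rⁱ f_* ℚ` (`D.IsGaussManin`), and ANY VHS datum `D'` on `S(ℂ)` embedded in `D` as a
sub-VHS datum (`IsSubVHSDatumOf`; `D` itself qualifies) whose level is `≥ 3` (`LevelAtLeast`,
Def. 3.12–3.13) and whose generic adjoint Mumford–Tate group is simple (`HasSimpleAdjointGroup`):
`HL(S, 𝕍'^⊗)_pos` (`VHSData.hodgeLocusPos D'`, Def. 1.2: the union of the strict special
subvarieties — BKU Lemma 3.6 on complex points, `IsStrictSpecialSubvariety` — of positive period
dimension, `HasPositivePeriodDimension`) is the union of a FINITE set of strict special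
subvarieties of `S` of positive period dimension. Zariski-closedness of `HL(S, 𝕍'^⊗)_pos` follows
(`hodgeLocusPos_isZariskiClosed_of`). Not rendered: atypicality of the finitely many maximal ones
(BKU's singular locus `S^sing_𝕍`, Def. 1.6, is not constructible in the tree).
-- TODO(general form): any polarizable `ℤ`VHS on a smooth connected quasi-projective `S`, and the
-- factorwise conclusion on `HL(S, 𝕍^⊗)_fpos` without "`G^ad` simple" (module docstring).
[cite: BaldiKlinglerUllmo2024, Thm. 2.6, Def. 1.2, Rmk. 1.4 and §7.1]
[file AlgebraicGeometry/Motives/HodgeLocusOfLevelAtLeastThree] -/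
def bku2024_hodgeLocusPos_finite_of_levelAtLeastThree : Prop :=
  ∀ (B : BettiHodgeData ℂ), B.IsClassical → ∀ [HodgeTensorFacts.{0, 0}]
    ⦃𝒳 S : SchemeOver ℂ⦄ (f : 𝒳 ⟶ S) (n i : ℕ) (D : GeometricVHSData B f n i),
    D.IsGaussManin → IsQuasiProjectiveOver S → AlgebraicGeometry.Smooth S.hom →
    IrreducibleSpace S.left →
    ∀ (D' : VHSData (ComplexPoints S) (i : ℤ)) [∀ s, Module.Finite ℚ (D'.V.fiber s)],
      D'.IsSubVHSDatumOf D.toVHSData → D'.LevelAtLeast 3 → D'.HasSimpleAdjointGroup →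
      ∃ F : Set (Set (ComplexPoints S)), F.Finite ∧
        (∀ Y ∈ F, D'.IsStrictSpecialSubvariety Y ∧ D'.HasPositivePeriodDimension Y) ∧
        D'.hodgeLocusPos = ⋃₀ F

/-! ### Consequences (proved) -/

section Consequences

variable [HodgeTensorFacts.{0, 0}] {S : SchemeOver ℂ} {m : ℤ}
  (D' : VHSData (ComplexPoints S) m) [∀ s, Module.Finite ℚ (D'.V.fiber s)]

/-- A finite union of (complex points of) irreducible closed subvarieties is Zariski-closed: if
`HL(S, 𝕍^⊗)_pos` is the union of a finite set of strict special subvarieties, it is Zariski-closed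
in `S(ℂ)` — the "hence is algebraic" of BKU Thm. 2.6. [cite: BaldiKlinglerUllmo2024, Thm. 2.6 and Rmk. 1.4] -/
theorem hodgeLocusPos_isZariskiClosed_of_eq_sUnion {F : Set (Set (ComplexPoints S))}
    (hF : F.Finite) (hspec : ∀ Y ∈ F, D'.IsStrictSpecialSubvariety Y)
    (heq : D'.hodgeLocusPos = ⋃₀ F) : IsZariskiClosedOnPoints S D'.hodgeLocusPos := by
  rw [isZariskiClosedOnPoints_iff_isClosed, heq]
  have hpre : zariskiSet S (⋃₀ F) = ⋃ Y ∈ F, zariskiSet S Y := by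
    ext P
    simp only [mem_zariskiSet_iff, Set.mem_sUnion, Set.mem_iUnion, exists_prop]
  rw [hpre]
  exact hF.isClosed_biUnion fun Y hY => (hspec Y hY).1.1.1

/-- **BKU Thm. 2.6, "hence is algebraic"** (given the fact): under its hypotheses
`HL(S, 𝕍'^⊗)_pos ⊆ S(ℂ)` is Zariski-closed. [cite: BaldiKlinglerUllmo2024, Thm. 2.6] -/
theorem hodgeLocusPos_isZariskiClosed_of (h : bku2024_hodgeLocusPos_finite_of_levelAtLeastThree)
    {B : BettiHodgeData ℂ} (hB : B.IsClassical) {𝒳 : SchemeOver ℂ} {f : 𝒳 ⟶ S} {n i : ℕ}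
    (D : GeometricVHSData B f n i) (hGM : D.IsGaussManin) (hqp : IsQuasiProjectiveOver S)
    (hsm : AlgebraicGeometry.Smooth S.hom) (hirr : IrreducibleSpace S.left)
    {D' : VHSData (ComplexPoints S) (i : ℤ)} [∀ s, Module.Finite ℚ (D'.V.fiber s)]
    (hsub : D'.IsSubVHSDatumOf D.toVHSData) (hlev : D'.LevelAtLeast 3)
    (hsimple : D'.HasSimpleAdjointGroup) : IsZariskiClosedOnPoints S D'.hodgeLocusPos := by
  obtain ⟨F, hF, hmem, heq⟩ := h B hB f n i D hGM hqp hsm hirr D' hsub hlev hsimple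
  exact hodgeLocusPos_isZariskiClosed_of_eq_sUnion D' hF (fun Y hY => (hmem Y hY).1) heq

/-- **BKU Thm. 2.6 for the full variation `Rⁱ f_* ℚ`** (given the fact; the case `D' = D`,
`IsSubVHSDatumOf.refl`): `HL(S, 𝕍^⊗)_pos` is the union of finitely many strict special
subvarieties of positive period dimension. [cite: BaldiKlinglerUllmo2024, Thm. 2.6] -/
theorem hodgeLocusPos_finite_of_geometric (h : bku2024_hodgeLocusPos_finite_of_levelAtLeastThree)
    {B : BettiHodgeData ℂ} (hB : B.IsClassical) {𝒳 : SchemeOver ℂ} {f : 𝒳 ⟶ S} {n i : ℕ}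
    (D : GeometricVHSData B f n i) [∀ s, Module.Finite ℚ (D.V.fiber s)] (hGM : D.IsGaussManin)
    (hqp : IsQuasiProjectiveOver S) (hsm : AlgebraicGeometry.Smooth S.hom)
    (hirr : IrreducibleSpace S.left) (hlev : D.toVHSData.LevelAtLeast 3)
    (hsimple : D.toVHSData.HasSimpleAdjointGroup) :
    ∃ F : Set (Set (ComplexPoints S)), F.Finite ∧
      (∀ Y ∈ F, D.toVHSData.IsStrictSpecialSubvariety Y ∧
        D.toVHSData.HasPositivePeriodDimension Y) ∧
      D.toVHSData.hodgeLocusPos = ⋃₀ F :=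
  h B hB f n i D hGM hqp hsm hirr D.toVHSData (VHSData.IsSubVHSDatumOf.refl _) hlev hsimple

end Consequences

/-! ### The companion for sub-VHS data: the Hodge locus is the countable union of the strict special
subvarieties (Cattani–Deligne–Kaplan 1995 = BKU Thm. 1.1, §3.2, §3.4)

Appended the same day by the same seat. The tree renders BKU Thm. 1.1 / CDK only for the FULL geometric
variation `Rⁱ f_* ℚ` (`SpecialSubvarietiesCountable`: `cdk1995_nonHodgeGenericLocus_countableCover`,
`countable_specialSubvarieties_meeting_affineOpen`; `HodgeTheory.cmsp_nonHodgeGenericPoints_countable_algebraic_cover`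
on the real carriers), whereas the consumer of `bku2024_hodgeLocusPos_finite_of_levelAtLeastThree` (memo
ROUTE-P3v17-g24-ADD4 §2 (7)–(8)) needs it for the SAME sub-VHS datum `D'` (`T^⊥`): "`B_D ⊂ HL(B, T^{⊥,⊗})` =
countable union of strict special subvarieties" and "the non-Hodge-generic points of `(B_D, T^⊥|_{B_D})` form a
countable union of strict closed algebraic subvarieties". Source, verbatim (held text `paper:arxiv-2107.08838`):
p. 3, **Thm. 1.1 (Cattani–Deligne–Kaplan)**: "Let `S` be a smooth connected complex quasi-projective algebraic
variety and `𝕍` be a polarizable `ℤ`VHS over `S`. Then `HL(S, 𝕍^⊗)` is a countable union of closed irreducible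
algebraic subvarieties of `S`: the (strict) special subvarieties of `S` for `𝕍`"; p. 9, §3.2: "Let `𝕍` be a
`ℤ`VHS on a smooth quasi-projective variety `S` and `Y ⊂ S` a closed irreducible algebraic subvariety (possibly
singular). A point `s` of `Y^an` is said to be Hodge-generic in `Y` for `𝕍` if `MT(𝕍_{s,ℚ})` has maximal
dimension when `s` ranges through `Y^an` … The Hodge locus `HL(S, 𝕍^⊗)` is also the subset of points of `S` which
are not Hodge-generic in `S` for `𝕍`"; p. 10, §3.4: "The Hodge locus `HL(S, 𝕍^⊗)` is then the countable union of
the strict special subvarieties of `S` for `𝕍`." -/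

/-- **The Hodge locus of a sub-VHS datum is the countable union of its strict special subvarieties, and the
non-Hodge-generic locus of every closed irreducible subvariety is covered by countably many strict closed
subvarieties** (Cattani–Deligne–Kaplan 1995, Thm. 1.1 / Cor. 1.2, in the form of Baldi–Klingler–Ullmo 2024,
Thm. 1.1 with §3.2 and §3.4, quoted in the section docstring). On the tree's carriers, with the honesty pin of
this file (module docstring, *Honesty*): for a classical Betti–Hodge datum `B`, a smooth projective family
`f : 𝒳 ⟶ S` over a smooth irreducible quasi-projective `ℂ`-scheme `S`, a Gauss–Manin geometric VHS datum `D` of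
`Rⁱ f_* ℚ` and ANY sub-VHS datum `D'` of `D` (`IsSubVHSDatumOf`; `D` itself qualifies):
(i) `HL(S, 𝕍'^⊗)` (`VHSData.hodgeLocus D'`: the points not Hodge-generic in `S`, BKU §3.2 verbatim) is the union
of a COUNTABLE set of strict special subvarieties of `S` for `D'` (`IsStrictSpecialSubvariety`, BKU Lemma 3.6 on
complex points) — Thm. 1.1 with §3.4; (ii) for every irreducible Zariski-closed `Z ⊆ S(ℂ)`
(`IsIrreducibleZariskiClosedOnPoints`, "possibly singular"), there are Zariski-closed `W k ⊆ S(ℂ)` (`k ∈ ℕ`), none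
containing `Z`, which together contain every point of `Z` that is not Hodge-generic in `Z`
(`D'.mtRankAt z < D'.genericMTRank Z`) — Thm. 1.1 applied to the pull-back of `𝕍'` to a resolution of `Z`
(Hironaka), whose generic Mumford–Tate group is `G_Z` (André 1992 §5: `MT(𝕍_z) ⊆ G_Z` on `Z`, equality off a
countable union of strict subvarieties), exactly as in the sibling `cdk1995_nonHodgeGenericLocus_countableCover`
(which is the case `D' = D`, localised to affine charts because it assumes no quasi-projectivity). When `Z` has no
non-generic point, `W k = ∅` qualifies (`Z ≠ ∅`).
-- TODO(general form): any polarizable `ℤ`VHS on a smooth connected quasi-projective `S` (only sub-VHS data of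
-- geometric variations `Rⁱ f_* ℚ` are rendered, through the pointwise Mumford–Tate ranks `VHSData.mtRankAt`).
[cite: BaldiKlinglerUllmo2024, Thm. 1.1, §3.2 and §3.4] [cite: CattaniDeligneKaplan1995JAMS, Thm. 1.1 and Cor. 1.2]
[cite: Andre1992, §5] [file AlgebraicGeometry/Motives/HodgeLocusOfLevelAtLeastThree] -/
def cdk1995_hodgeLocus_subVHS_countable_strictSpecial : Prop :=
  ∀ (B : BettiHodgeData ℂ), B.IsClassical → ∀ [HodgeTensorFacts.{0, 0}]
    ⦃𝒳 S : SchemeOver ℂ⦄ (f : 𝒳 ⟶ S) (n i : ℕ) (D : GeometricVHSData B f n i),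
    D.IsGaussManin → IsQuasiProjectiveOver S → AlgebraicGeometry.Smooth S.hom →
    IrreducibleSpace S.left →
    ∀ (D' : VHSData (ComplexPoints S) (i : ℤ)) [∀ s, Module.Finite ℚ (D'.V.fiber s)],
      D'.IsSubVHSDatumOf D.toVHSData →
      (∃ 𝓢 : Set (Set (ComplexPoints S)), 𝓢.Countable ∧
          (∀ Y ∈ 𝓢, D'.IsStrictSpecialSubvariety Y) ∧ D'.hodgeLocus = ⋃₀ 𝓢) ∧
      ∀ Z : Set (ComplexPoints S), IsIrreducibleZariskiClosedOnPoints S Z →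
        ∃ W : ℕ → Set (ComplexPoints S), (∀ k, IsZariskiClosedOnPoints S (W k) ∧ ¬ Z ⊆ W k) ∧
          ∀ z ∈ Z, D'.mtRankAt z < D'.genericMTRank Z → ∃ k, z ∈ W k

section CountableConsequences

variable [HodgeTensorFacts.{0, 0}] {S : SchemeOver ℂ}

/-- **BKU Thm. 1.1 for the full variation `Rⁱ f_* ℚ` on a quasi-projective base** (given the fact; the case
`D' = D`): `HL(S, 𝕍^⊗)` is the union of countably many strict special subvarieties.
[cite: BaldiKlinglerUllmo2024, Thm. 1.1 and §3.4] -/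
theorem hodgeLocus_eq_sUnion_countable_of_geometric (h : cdk1995_hodgeLocus_subVHS_countable_strictSpecial)
    {B : BettiHodgeData ℂ} (hB : B.IsClassical) {𝒳 : SchemeOver ℂ} {f : 𝒳 ⟶ S} {n i : ℕ}
    (D : GeometricVHSData B f n i) [∀ s, Module.Finite ℚ (D.V.fiber s)] (hGM : D.IsGaussManin)
    (hqp : IsQuasiProjectiveOver S) (hsm : AlgebraicGeometry.Smooth S.hom)
    (hirr : IrreducibleSpace S.left) :
    ∃ 𝓢 : Set (Set (ComplexPoints S)), 𝓢.Countable ∧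
      (∀ Y ∈ 𝓢, D.toVHSData.IsStrictSpecialSubvariety Y) ∧ D.toVHSData.hodgeLocus = ⋃₀ 𝓢 :=
  (h B hB f n i D hGM hqp hsm hirr D.toVHSData (VHSData.IsSubVHSDatumOf.refl _)).1

/-- **Points off all the strict special subvarieties are Hodge-generic** (given the fact): a point of `S(ℂ)`
lying on no member of the countable family of clause (i) is Hodge-generic in `S` for `D'`.
[cite: BaldiKlinglerUllmo2024, §3.2 and §3.4] -/
theorem isHodgeGenericIn_of_forall_not_mem (h : cdk1995_hodgeLocus_subVHS_countable_strictSpecial)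
    {B : BettiHodgeData ℂ} (hB : B.IsClassical) {𝒳 : SchemeOver ℂ} {f : 𝒳 ⟶ S} {n i : ℕ}
    (D : GeometricVHSData B f n i) (hGM : D.IsGaussManin) (hqp : IsQuasiProjectiveOver S)
    (hsm : AlgebraicGeometry.Smooth S.hom) (hirr : IrreducibleSpace S.left)
    {D' : VHSData (ComplexPoints S) (i : ℤ)} [∀ s, Module.Finite ℚ (D'.V.fiber s)]
    (hsub : D'.IsSubVHSDatumOf D.toVHSData) :
    ∃ 𝓢 : Set (Set (ComplexPoints S)), 𝓢.Countable ∧ (∀ Y ∈ 𝓢, D'.IsStrictSpecialSubvariety Y) ∧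
      ∀ s : ComplexPoints S, (∀ Y ∈ 𝓢, s ∉ Y) → D'.IsHodgeGenericIn Set.univ s := by
  obtain ⟨⟨𝓢, h𝓢, hspec, heq⟩, -⟩ := h B hB f n i D hGM hqp hsm hirr D' hsub
  refine ⟨𝓢, h𝓢, hspec, fun s hs => ?_⟩
  by_contra hgen
  have hmem : s ∈ D'.hodgeLocus := hgen
  rw [heq, Set.mem_sUnion] at hmem
  obtain ⟨Y, hY, hsY⟩ := hmem
  exact hs Y hY hsY

end CountableConsequences

end Literature.AlgebraicGeometry.Motives

end
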